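import Mathlib.RingTheory.RootsOfUnity.AlgebraicallyClosed
import Mathlib.Data.ZMod.Units
import Mathlib.FieldTheory.IsAlgClosed.AlgebraicClosure
import Mathlib.NumberTheory.Padics.PadicNumbers
import Literature.AnabelianGeometry.EtaleTheta.ZHatLevelDetermination
import HarnessLib

/-!
# `Λ(R^×) ≅ Ẑ`: the cyclotome of a domain with enough roots of unity is the profinite completion of `ℤ`

Classical profinite group theory [RibesZalesskii2010, Thm 2.7.1] (`Ẑ = lim_n ℤ/nℤ`), serving the printed
identifications «`μ_Ẑ(K̄) = Hom(ℚ/ℤ, μ_{ℚ/ℤ}(K̄))` … the natural isomorphism `μ_Ẑ(K̄) ≅ Ẑ(1)`» of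
[SemiAnbd] Thm. 6.12 p. 78 / [Mzk8] Thm. 4.3 and «`μ_Ẑ(G_k) := Hom(ℚ/ℤ, μ_{ℚ/ℤ}(G_k))` (≅ `Ẑ(1)`)» of
[AbsTopIII] Def. 3.1 (v) p. 69, AT THE LEVEL OF ABSTRACT GROUPS (the Galois action — the Tate twist — is
forgotten).  Objects: the tree's inverse-limit cyclotome `EtaleTheta.cyclotome A = lim_n A[n]`
(`Cyclotome.lean`, [LANA2026Report] §6.1 p. 31) and Mathlib's
`Ẑ := ProfiniteGrp.ProfiniteCompletion.completion (GrpCat.of (Multiplicative ℤ))` (= the tree's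
`SemiGraphs.ZHat` / `IUT.HodgeTheaters.ZHat`, both `abbrev`s), with the level characters
`ZHatLevel.level n : Ẑ →* ℤ/nℤ` (`CyclotomeZHatAction.lean`) and the presentation `Ẑ → lim_n ℤ/nℤ`
(`ZHatLevel.ext_of_level`, `ZHatLevel.LevelFamily`, `ZHatLevel.powEnd` of `ZHatLevelDetermination.lean`).

PROOF-ONLY (no definitions).  For a commutative domain `R` admitting a primitive `n`-th root of unity for every
`n ≥ 1` (e.g. any separably closed field of characteristic `0`, such as `ℚ̄_p = AlgebraicClosure ℚ_[p]`):

* `cyclotome.exists_isPrimitiveRoot_pow_eq` — a primitive `m`-th root lifts to a primitive `dm`-th root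
  under `ζ ↦ ζ^d` (the surjection `(ℤ/dmℤ)^× ↠ (ℤ/mℤ)^×`, Mathlib `ZMod.unitsMap_surjective`);
* `cyclotome.exists_generator` — **`Λ(R^×)` has a GENERATOR**: a compatible system `ξ = (ξ_n)_n` with
  `ξ_n` a primitive `n`-th root for every `n` (dependent choice along the factorial tower `n!`);
* `cyclotome.exists_mulEquiv_zHat_of_generator` — **`Λ(R^×) ≃* Ẑ`**, `ξ ↦ η(1)`, characterised by
  `ζ_n = ξ_n ^ (level_n (e ζ))` (discrete logarithms to the base `ξ`, level by level);
* `cyclotome.exists_generator_mulEquiv_zHat`, `cyclotome.nonempty_mulEquiv_zHat` — the packaged forms, and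
  the instances `…_of_isSepClosed` (separably closed, characteristic `0`) and
  `cyclotome.padicAlgCl_nonempty_mulEquiv_zHat` (`Λ(ℚ̄_pˣ) ≃* Ẑ`, the cyclotome `μ_Ẑ(K̄)` of
  [SemiAnbd] §6 / the abc-iut L3 interface `CyclotomeTransport`).

HONEST FRAMING: classical bricks; the isomorphism is NOT canonical (it depends on the generator `ξ`, i.e. on an
orientation of `Ẑ(1)`), exactly as in print where `μ_Ẑ ≅ Ẑ(1)` is canonical only as a `G_K`-module up to
`Ẑ^×`; nothing here bears on [IUTchIII] Cor. 3.12; no side is taken on any disputed claim.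
-/

noncomputable section

open CategoryTheory ProfiniteGrp ProfiniteGrp.ProfiniteCompletion

namespace Literature.AnabelianGeometry.EtaleTheta

namespace cyclotome

universe u

variable {R : Type u} [CommRing R] [IsDomain R]

/-! ## Lifting primitive roots of unity -/

/-- **Lifting primitive roots.** If `R` has a primitive `dm`-th root of unity, then every primitive `m`-th root
`η` is the `d`-th power of a primitive `dm`-th root: the `d`-th power map sends primitive `dm`-th roots ONTO
the primitive `m`-th roots, because `(ℤ/dmℤ)^× → (ℤ/mℤ)^×` is surjective. [cite: RibesZalesskii2010, Thm 2.7.1] -/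
theorem exists_isPrimitiveRoot_pow_eq {m d : ℕ} (hm : 0 < m) (hd : 0 < d) {ω : R}
    (hω : IsPrimitiveRoot ω (d * m)) {η : R} (hη : IsPrimitiveRoot η m) :
    ∃ ζ : R, IsPrimitiveRoot ζ (d * m) ∧ ζ ^ d = η := by
  haveI : NeZero m := ⟨hm.ne'⟩
  haveI : NeZero (d * m) := ⟨(Nat.mul_pos hd hm).ne'⟩
  -- `ω ^ d` is a primitive `m`-th root, so `η` is a unit power of it
  have hωd : IsPrimitiveRoot (ω ^ d) m := by
    have h := hω.pow_of_dvd hd.ne' (dvd_mul_right d m)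
    rwa [Nat.mul_div_cancel_left m hd] at h
  obtain ⟨i, -, hiη⟩ := hωd.eq_pow_of_pow_eq_one hη.pow_eq_one
  have hic : i.Coprime m := (hωd.pow_iff_coprime hm i).1 (hiη ▸ hη)
  -- lift the unit `i mod m` to a unit `v mod dm`
  obtain ⟨v, hv⟩ := ZMod.unitsMap_surjective (dvd_mul_left m d) (ZMod.unitOfCoprime i hic)
  refine ⟨ω ^ (v : ZMod (d * m)).val, hω.pow_of_coprime _ (ZMod.val_coe_unit_coprime v), ?_⟩
  have hmod : (v : ZMod (d * m)).val % m = i % m := by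
    have h1 := congrArg (fun u : (ZMod m)ˣ => (u : ZMod m)) hv
    simp only [ZMod.unitsMap_val, ZMod.coe_unitOfCoprime] at h1
    rw [ZMod.cast_eq_val] at h1
    exact (ZMod.natCast_eq_natCast_iff' _ _ _).1 h1
  rw [pow_right_comm, ← hiη, pow_eq_pow_mod _ hωd.pow_eq_one, pow_eq_pow_mod i hωd.pow_eq_one, hmod]

/-! ## A generator of the cyclotome -/

/-- **A compatible system of primitive roots along the factorial tower**: if `R` has primitive roots of
unity of every order, there are primitive `k!`-th roots `s_k` with `s_{k+1}^{k+1} = s_k` (dependent choice,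
one lift at a time). [cite: RibesZalesskii2010, Thm 2.7.1] -/
theorem exists_factorial_tower (hprim : ∀ n : ℕ, 0 < n → ∃ ζ : R, IsPrimitiveRoot ζ n) :
    ∃ s : ℕ → R, (∀ k, IsPrimitiveRoot (s k) (Nat.factorial k)) ∧ ∀ k, s (k + 1) ^ (k + 1) = s k := by
  have step : ∀ (k : ℕ) (η : R), IsPrimitiveRoot η (Nat.factorial k) →
      ∃ ζ : R, IsPrimitiveRoot ζ (Nat.factorial (k + 1)) ∧ ζ ^ (k + 1) = η := by
    intro k η hη
    obtain ⟨ω, hω⟩ := hprim ((k + 1) * Nat.factorial k) (Nat.mul_pos k.succ_pos (Nat.factorial_pos k))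
    obtain ⟨ζ, hζ, hζη⟩ := exists_isPrimitiveRoot_pow_eq (Nat.factorial_pos k) k.succ_pos hω hη
    exact ⟨ζ, by rwa [Nat.factorial_succ], hζη⟩
  choose f hf hf' using step
  let T : ℕ → Type u := fun k => {η : R // IsPrimitiveRoot η (Nat.factorial k)}
  let s : ∀ k, T k := fun k =>
    Nat.rec (motive := T) ⟨1, by rw [Nat.factorial_zero]; exact IsPrimitiveRoot.one⟩
      (fun k x => ⟨f k x.1 x.2, hf k x.1 x.2⟩) k
  exact ⟨fun k => (s k).1, fun k => (s k).2, fun k => hf' k (s k).1 (s k).2⟩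

/-- Along a factorial tower, `s_K ^ (K!/k!) = s_k` for `k ≤ K` (stated without division: there is `q` with
`k! · q = K!` and `s_K ^ q = s_k`). [cite: RibesZalesskii2010, Thm 2.7.1] -/
theorem factorial_tower_pow {M : Type*} [Monoid M] {s : ℕ → M} (hs : ∀ k, s (k + 1) ^ (k + 1) = s k)
    {k K : ℕ} (hkK : k ≤ K) :
    ∃ q : ℕ, Nat.factorial k * q = Nat.factorial K ∧ s K ^ q = s k := by
  induction K, hkK using Nat.le_induction with
  | base => exact ⟨1, by rw [mul_one], by rw [pow_one]⟩
  | succ K _ ih =>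
    obtain ⟨q, hq, hsq⟩ := ih
    refine ⟨(K + 1) * q, ?_, ?_⟩
    · rw [Nat.factorial_succ, ← hq]; ring
    · rw [pow_mul, hs K, hsq]

/-- **The cyclotome `Λ(R^×)` has a generator**: if the domain `R` has a primitive `n`-th root of unity for
every `n ≥ 1`, there is `ξ ∈ Λ(R^×) = lim_n μ_n(R)` whose every component `ξ_n` is a PRIMITIVE `n`-th root
(`ξ_n := s_n ^ ((n-1)!)` for a factorial tower `s`). [cite: RibesZalesskii2010, Thm 2.7.1] -/
theorem exists_generator (hprim : ∀ n : ℕ, 0 < n → ∃ ζ : R, IsPrimitiveRoot ζ n) :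
    ∃ ξ : cyclotome Rˣ, ∀ n : ℕ+, IsPrimitiveRoot ((ξ : ℕ+ → Rˣ) n) (n : ℕ) := by
  obtain ⟨s, hs, hs'⟩ := exists_factorial_tower hprim
  -- the units `u k = s k`
  let u : ℕ → Rˣ := fun k => ((hs k).isUnit (Nat.factorial_ne_zero k)).unit
  have hu : ∀ k, (u k : R) = s k := fun k => rfl
  have hu' : ∀ k, IsPrimitiveRoot (u k) (Nat.factorial k) := fun k =>
    IsPrimitiveRoot.coe_units_iff.mp (by rw [hu]; exact hs k)
  have hus : ∀ k, u (k + 1) ^ (k + 1) = u k := fun k =>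
    Units.ext (by rw [Units.val_pow_eq_pow_val, hu, hu, hs' k])
  -- `ξ n := u n ^ (n-1)!`, written with `k := n.natPred`, `n = k + 1`
  let ξf : ℕ+ → Rˣ := fun n => u (n.natPred + 1) ^ Nat.factorial n.natPred
  have hξprim : ∀ n : ℕ+, IsPrimitiveRoot (ξf n) (n : ℕ) := by
    intro n
    have h := (hu' (n.natPred + 1)).pow (Nat.factorial_pos _)
      (show Nat.factorial (n.natPred + 1) = Nat.factorial n.natPred * (n.natPred + 1) by
        rw [Nat.factorial_succ]; ring)
    have e : (n.natPred + 1 : ℕ) = n := PNat.natPred_add_one n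
    exact IsPrimitiveRoot.iff_orderOf.2 (e ▸ IsPrimitiveRoot.iff_orderOf.1 h)
  refine ⟨⟨ξf, fun n => (hξprim n).pow_eq_one, fun n m => ?_⟩, hξprim⟩
  -- compatibility `ξ (n m) ^ m = ξ n` through the tower between levels `n = k+1` and `n m = K+1`
  set k := n.natPred with hk
  set K := (n * m).natPred with hK
  have hn : (n : ℕ) = k + 1 := (PNat.natPred_add_one n).symm
  have hnm : ((n * m : ℕ+) : ℕ) = K + 1 := (PNat.natPred_add_one (n * m)).symm
  have hKk : K + 1 = (k + 1) * m := by rw [← hnm, ← hn, PNat.mul_coe]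
  have hle : k + 1 ≤ K + 1 := by
    rw [hKk]
    exact Nat.le_mul_of_pos_right _ m.pos
  obtain ⟨q, hq, huq⟩ := factorial_tower_pow hus hle
  -- exponent bookkeeping: `K! · m = q · k!`
  have hexp : Nat.factorial K * (m : ℕ) = q * Nat.factorial k := by
    have h1 : (k + 1) * (Nat.factorial K * (m : ℕ)) = (k + 1) * (q * Nat.factorial k) := by
      calc (k + 1) * (Nat.factorial K * (m : ℕ)) = Nat.factorial K * ((k + 1) * m) := by ring
        _ = Nat.factorial (K + 1) := by rw [← hKk, Nat.factorial_succ]; ring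
        _ = Nat.factorial (k + 1) * q := hq.symm
        _ = (k + 1) * (q * Nat.factorial k) := by rw [Nat.factorial_succ]; ring
    exact Nat.eq_of_mul_eq_mul_left k.succ_pos h1
  change (u (K + 1) ^ Nat.factorial K) ^ (m : ℕ) = u (k + 1) ^ Nat.factorial k
  rw [← pow_mul, hexp, pow_mul, huq]

/-! ## The isomorphism with `Ẑ` attached to a generator -/

/-- Powers of a primitive `n`-th root agree iff the exponents agree mod `n`. [cite: RibesZalesskii2010, Thm 2.7.1] -/
theorem pow_eq_pow_iff_mod_eq {M : Type*} [CommGroup M] {ζ : M} {n : ℕ} (h : IsPrimitiveRoot ζ n)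
    (a b : ℕ) : ζ ^ a = ζ ^ b ↔ a % n = b % n := by
  rw [pow_eq_pow_iff_modEq, ← h.eq_orderOf]; rfl

/-- **`Λ(R^×) ≃* Ẑ` from a generator.**  Given `ξ ∈ Λ(R^×)` with every `ξ_n` a primitive `n`-th root, there is
a group isomorphism `e : Λ(R^×) ≃* Ẑ` with `e ξ = η(1)`, characterised by: for all `ζ` and `n`,
`ζ_n = ξ_n ^ (level_n (e ζ))` — i.e. `e ζ` is the compatible family of DISCRETE LOGARITHMS of the
components of `ζ` to the base `ξ` (an element of `lim_n ℤ/nℤ = Ẑ`).  Injectivity is immediate; surjectivity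
is `z ↦ (ξ_n ^ level_n z)_n`; the homomorphism property is `log (ζζ') = log ζ + log ζ'` level by level
(`ZHatLevel.ext_of_level`). [cite: RibesZalesskii2010, Thm 2.7.1] -/
theorem exists_mulEquiv_zHat_of_generator (ξ : cyclotome Rˣ)
    (hξ : ∀ n : ℕ+, IsPrimitiveRoot ((ξ : ℕ+ → Rˣ) n) (n : ℕ)) :
    ∃ e : cyclotome Rˣ ≃* completion (GrpCat.of (Multiplicative ℤ)),
      e ξ = ZHatLevel.eta 1 ∧
      ∀ (ζ : cyclotome Rˣ) (n : ℕ+),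
        (ξ : ℕ+ → Rˣ) n ^ (Multiplicative.toAdd (ZHatLevel.level n (e ζ))).val = (ζ : ℕ+ → Rˣ) n := by
  classical
  -- discrete logarithms, level by level
  have hdl : ∀ (ζ : cyclotome Rˣ) (n : ℕ+), ∃ i : ℕ, (ξ : ℕ+ → Rˣ) n ^ i = (ζ : ℕ+ → Rˣ) n := by
    intro ζ n
    haveI : NeZero (n : ℕ) := NeZero.of_pos n.pos
    obtain ⟨i, -, hi⟩ := (hξ n).eq_pow_of_mem_rootsOfUnity
      ((mem_rootsOfUnity (n : ℕ) ((ζ : ℕ+ → Rˣ) n)).2 (pow_eq_one ζ n))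
    exact ⟨i, hi⟩
  choose d hd using hdl
  -- exponents to the base `ξ_n` are determined mod `n`
  have hmod : ∀ {n : ℕ+} {a b : ℕ}, (ξ : ℕ+ → Rˣ) n ^ a = (ξ : ℕ+ → Rˣ) n ^ b → a % (n : ℕ) = b % (n : ℕ) :=
    fun {n a b} h => (pow_eq_pow_iff_mod_eq (hξ n) a b).1 h
  have hcast : ∀ {n : ℕ+} {a b : ℕ}, (ξ : ℕ+ → Rˣ) n ^ a = (ξ : ℕ+ → Rˣ) n ^ b → (a : ZMod n) = (b : ZMod n) :=
    fun {n a b} h => (ZMod.natCast_eq_natCast_iff' _ _ _).2 (hmod h)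
  -- `ξ_n = ξ_{nm} ^ m` and the induced relation between levels
  have hlev : ∀ (ζ : cyclotome Rˣ) (n m : ℕ+),
      (ξ : ℕ+ → Rˣ) n ^ d ζ (n * m) = (ζ : ℕ+ → Rˣ) n := by
    intro ζ n m
    rw [← pow_apply_mul ξ n m, pow_right_comm, hd ζ (n * m), pow_apply_mul ζ n m]
  -- the compatible family of discrete logarithms of `ζ`
  have hcompat : ∀ (ζ : cyclotome Rˣ) (n N : ℕ+) (h : (n : ℕ) ∣ N),
      ZMod.castHom h (ZMod n) ((d ζ N : ℕ) : ZMod N) = (d ζ n : ZMod n) := by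
    intro ζ n N h
    obtain ⟨m, rfl⟩ : ∃ m : ℕ+, N = n * m := PNat.dvd_iff.2 h
    rw [map_natCast]
    exact hcast ((hlev ζ n m).trans (hd ζ n).symm)
  let fam : cyclotome Rˣ → ZHatLevel.LevelFamily := fun ζ =>
    { c := fun n => (d ζ n : ZMod n)
      compat := fun n N h => hcompat ζ n N h }
  -- the map `Ψ ζ := η(1) ^ (log_ξ ζ)`
  let Ψ : cyclotome Rˣ → completion (GrpCat.of (Multiplicative ℤ)) := fun ζ =>
    ZHatLevel.powEnd (fam ζ) (ZHatLevel.eta 1)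
  have hΨlevel : ∀ (ζ : cyclotome Rˣ) (n : ℕ+),
      Multiplicative.toAdd (ZHatLevel.level n (Ψ ζ)) = (d ζ n : ZMod n) := by
    intro ζ n
    change Multiplicative.toAdd (ZHatLevel.level n (ZHatLevel.powEnd (fam ζ) (ZHatLevel.eta 1))) = _
    rw [ZHatLevel.toAdd_level_powEnd, ZHatLevel.level_eta, toAdd_ofAdd, Int.cast_one, mul_one]
  -- homomorphism
  have hΨmul : ∀ ζ ζ' : cyclotome Rˣ, Ψ (ζ * ζ') = Ψ ζ * Ψ ζ' := by
    intro ζ ζ'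
    refine ZHatLevel.ext_of_level fun n => ?_
    apply Multiplicative.toAdd.injective
    rw [map_mul, toAdd_mul, hΨlevel, hΨlevel, hΨlevel, ← Nat.cast_add]
    apply hcast
    rw [hd, pow_add, hd, hd]
    rfl
  let Ψh : cyclotome Rˣ →* completion (GrpCat.of (Multiplicative ℤ)) := MonoidHom.mk' Ψ hΨmul
  -- injective
  have hΨinj : Function.Injective Ψh := by
    refine (injective_iff_map_eq_one Ψh).2 fun ζ hζ => ?_
    refine Subtype.ext (funext fun n => ?_)
    have h1 : (d ζ n : ZMod n) = 0 := by
      rw [← hΨlevel ζ n]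
      change Multiplicative.toAdd (ZHatLevel.level n (Ψh ζ)) = 0
      rw [hζ, map_one, toAdd_one]
    have h2 : (n : ℕ) ∣ d ζ n := (ZMod.natCast_eq_zero_iff _ _).1 h1
    change (ζ : ℕ+ → Rˣ) n = 1
    rw [← hd ζ n, (hξ n).pow_eq_one_iff_dvd]
    exact h2
  -- surjective
  have hΨsurj : Function.Surjective Ψh := by
    intro z
    let a : ℕ+ → ℕ := fun n => (Multiplicative.toAdd (ZHatLevel.level n z)).val
    have hamod : ∀ n m : ℕ+, a (n * m) % (n : ℕ) = a n % (n : ℕ) := by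
      intro n m
      have h := (ZHatLevel.LevelFamily.ofZHat z).val_mod (n := n) (N := n * m)
        (by rw [PNat.mul_coe]; exact dvd_mul_right _ _)
      simp only [ZHatLevel.LevelFamily.ofZHat_c] at h
      change a (n * m) % (n : ℕ) = a n at h
      rw [h, Nat.mod_eq_of_lt]
      haveI : NeZero (n : ℕ) := NeZero.of_pos n.pos
      exact ZMod.val_lt _
    let ζf : ℕ+ → Rˣ := fun n => (ξ : ℕ+ → Rˣ) n ^ a n
    have hζmem : ζf ∈ cyclotome Rˣ := by
      refine ⟨fun n => ?_, fun n m => ?_⟩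
      · change ((ξ : ℕ+ → Rˣ) n ^ a n) ^ (n : ℕ) = 1
        rw [pow_right_comm, (hξ n).pow_eq_one, one_pow]
      · change ((ξ : ℕ+ → Rˣ) (n * m) ^ a (n * m)) ^ (m : ℕ) = (ξ : ℕ+ → Rˣ) n ^ a n
        rw [pow_right_comm, pow_apply_mul ξ n m, pow_eq_pow_mod _ (hξ n).pow_eq_one,
          hamod, ← pow_eq_pow_mod _ (hξ n).pow_eq_one]
    refine ⟨⟨ζf, hζmem⟩, ZHatLevel.ext_of_level fun n => ?_⟩
    apply Multiplicative.toAdd.injective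
    haveI : NeZero (n : ℕ) := NeZero.of_pos n.pos
    change Multiplicative.toAdd (ZHatLevel.level n (Ψ ⟨ζf, hζmem⟩)) = _
    rw [hΨlevel, ← ZMod.natCast_zmod_val (Multiplicative.toAdd (ZHatLevel.level n z))]
    apply hcast
    rw [hd]
  refine ⟨MulEquiv.ofBijective Ψh ⟨hΨinj, hΨsurj⟩, ?_, fun ζ n => ?_⟩
  · -- `e ξ = η(1)`: all discrete logarithms of `ξ` are `1`
    refine ZHatLevel.ext_of_level fun n => ?_
    apply Multiplicative.toAdd.injective
    change Multiplicative.toAdd (ZHatLevel.level n (Ψ ξ)) = _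
    rw [hΨlevel, ZHatLevel.level_eta, toAdd_ofAdd, Int.cast_one, ← Nat.cast_one]
    apply hcast
    rw [hd, pow_one]
  · -- the characterisation
    haveI : NeZero (n : ℕ) := NeZero.of_pos n.pos
    change (ξ : ℕ+ → Rˣ) n ^ (Multiplicative.toAdd (ZHatLevel.level n (Ψ ζ))).val = _
    rw [← hd ζ n]
    apply ((pow_eq_pow_iff_mod_eq (hξ n) _ _).2)
    apply (ZMod.natCast_eq_natCast_iff' _ _ _).1
    rw [ZMod.natCast_zmod_val, hΨlevel]

/-! ## Packaged statements -/

/-- **`Λ(R^×) ≃* Ẑ` with a generator going to `η(1)`**, for a domain `R` with primitive roots of unity of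
every order: there are a generator `ξ` of the cyclotome (every `ξ_n` primitive) and a group isomorphism
`e : Λ(R^×) ≃* Ẑ` with `e ξ = η(1)` and `ζ_n = ξ_n ^ (level_n (e ζ))` for all `ζ`, `n`.
[cite: RibesZalesskii2010, Thm 2.7.1] -/
theorem exists_generator_mulEquiv_zHat (hprim : ∀ n : ℕ, 0 < n → ∃ ζ : R, IsPrimitiveRoot ζ n) :
    ∃ (ξ : cyclotome Rˣ) (e : cyclotome Rˣ ≃* completion (GrpCat.of (Multiplicative ℤ))),
      (∀ n : ℕ+, IsPrimitiveRoot ((ξ : ℕ+ → Rˣ) n) (n : ℕ)) ∧ e ξ = ZHatLevel.eta 1 ∧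
      ∀ (ζ : cyclotome Rˣ) (n : ℕ+),
        (ξ : ℕ+ → Rˣ) n ^ (Multiplicative.toAdd (ZHatLevel.level n (e ζ))).val = (ζ : ℕ+ → Rˣ) n := by
  obtain ⟨ξ, hξ⟩ := exists_generator hprim
  obtain ⟨e, he, he'⟩ := exists_mulEquiv_zHat_of_generator ξ hξ
  exact ⟨ξ, e, hξ, he, he'⟩

/-- **`Λ(R^×) ≅ Ẑ` (abstract groups)** for a domain `R` with primitive roots of unity of every order.
[cite: RibesZalesskii2010, Thm 2.7.1] -/
theorem nonempty_mulEquiv_zHat (hprim : ∀ n : ℕ, 0 < n → ∃ ζ : R, IsPrimitiveRoot ζ n) :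
    Nonempty (cyclotome Rˣ ≃* completion (GrpCat.of (Multiplicative ℤ))) := by
  obtain ⟨-, e, -⟩ := exists_generator_mulEquiv_zHat hprim
  exact ⟨e⟩

/-- A separably closed field of characteristic `0` has primitive roots of unity of every order (Mathlib's
`HasEnoughRootsOfUnity`). [cite: RibesZalesskii2010, Thm 2.7.1] -/
theorem exists_isPrimitiveRoot_of_isSepClosed (K : Type u) [Field K] [IsSepClosed K] [CharZero K]
    (n : ℕ) (hn : 0 < n) : ∃ ζ : K, IsPrimitiveRoot ζ n := by
  haveI : NeZero n := ⟨hn.ne'⟩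
  exact HasEnoughRootsOfUnity.exists_primitiveRoot K n

/-- **`Λ(K^×) ≃* Ẑ` for `K` separably closed of characteristic `0`** (so for every algebraically closed
field of characteristic `0`), with a generator `ξ ↦ η(1)` and the discrete-logarithm characterisation.
[cite: RibesZalesskii2010, Thm 2.7.1] -/
theorem exists_generator_mulEquiv_zHat_of_isSepClosed (K : Type u) [Field K] [IsSepClosed K] [CharZero K] :
    ∃ (ξ : cyclotome Kˣ) (e : cyclotome Kˣ ≃* completion (GrpCat.of (Multiplicative ℤ))),
      (∀ n : ℕ+, IsPrimitiveRoot ((ξ : ℕ+ → Kˣ) n) (n : ℕ)) ∧ e ξ = ZHatLevel.eta 1 ∧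
      ∀ (ζ : cyclotome Kˣ) (n : ℕ+),
        (ξ : ℕ+ → Kˣ) n ^ (Multiplicative.toAdd (ZHatLevel.level n (e ζ))).val = (ζ : ℕ+ → Kˣ) n :=
  exists_generator_mulEquiv_zHat (exists_isPrimitiveRoot_of_isSepClosed K)

/-- `Λ(K^×) ≅ Ẑ` for `K` separably closed of characteristic `0`. [cite: RibesZalesskii2010, Thm 2.7.1] -/
theorem nonempty_mulEquiv_zHat_of_isSepClosed (K : Type u) [Field K] [IsSepClosed K] [CharZero K] :
    Nonempty (cyclotome Kˣ ≃* completion (GrpCat.of (Multiplicative ℤ))) :=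
  nonempty_mulEquiv_zHat (exists_isPrimitiveRoot_of_isSepClosed K)

/-- **`μ_Ẑ(K̄) ≅ Ẑ(1)` as abstract groups for `K̄ = ℚ̄_p`**: the cyclotome `Λ(ℚ̄_pˣ) = lim_n μ_n(ℚ̄_p)` of
[SemiAnbd] Thm. 6.12 (`μ_Ẑ(K̄) = Hom(ℚ/ℤ, μ_{ℚ/ℤ}(K̄))`, the tree's `cyclotome (AlgebraicClosure ℚ_[p])ˣ` in the
L3 interface `SemiGraphs.CyclotomeTransport`) is isomorphic to `Ẑ` = the tree's `SemiGraphs.ZHat`.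
[cite: MochizukiSemiAnbd2006, Thm 6.12 p.78] -/
theorem padicAlgCl_nonempty_mulEquiv_zHat (p : ℕ) [Fact p.Prime] :
    Nonempty (cyclotome (AlgebraicClosure ℚ_[p])ˣ ≃* completion (GrpCat.of (Multiplicative ℤ))) := by
  haveI : CharZero (AlgebraicClosure ℚ_[p]) :=
    charZero_of_injective_algebraMap (algebraMap ℚ_[p] (AlgebraicClosure ℚ_[p])).injective
  exact nonempty_mulEquiv_zHat_of_isSepClosed (AlgebraicClosure ℚ_[p])

end cyclotome

end Literature.AnabelianGeometry.EtaleTheta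

end
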